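import Mathlib
import HarnessLib
import Summits.ValiantsHypothesis.ValiantsHypothesis.Theses.MonotoneRestoration
import Literature.Computability.AlgebraicComplexity.ArithCircuit
import Literature.Computability.AlgebraicComplexity.ArithCircuitProofs
import Literature.Computability.AlgebraicComplexity.MonotoneStructure
import Literature.Computability.AlgebraicComplexity.PermanentIrreducible
import Literature.ModelTheory.FiniteModelTheory.CkEquiv
import Summits.ValiantsHypothesis.ValiantsHypothesis.Theorems.MonotoneRestorationMonotoneRestorationQPCosetCount
import Summits.ValiantsHypothesis.ValiantsHypothesis.Theorems.MonotoneRestorationMonotoneRestorationQPSymmetricLB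
import Summits.ValiantsHypothesis.ValiantsHypothesis.Theorems.MonotoneRestorationMonotoneRestorationQPSupportSymmetrisation
import Summits.ValiantsHypothesis.ValiantsHypothesis.Theorems.MonotoneRestorationMonotoneRestorationQPSparseRegime
import Summits.ValiantsHypothesis.ValiantsHypothesis.Theorems.MonotoneRestorationMonotoneRestorationQPBeta
import Literature.Computability.AlgebraicComplexity.SymmetricArithCircuit
import Literature.Computability.AlgebraicComplexity.DawarWilsenach2025Proofs
import Literature.GroupTheory.PermutationGroups.SmallIndexSubgroups
import Summits.ValiantsHypothesis.ValiantsHypothesis.Theorems.MonotoneRestorationQP.Negative.LoadBearing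
import Summits.ValiantsHypothesis.ValiantsHypothesis.Theorems.MonotoneRestorationMonotoneRestorationQPPermSupportCount

/-! # TTRL-lite variant V19261 of `MonotoneRestorationQP` / `stub_esymmRowSums_complexity` (stmt-ValiantsHypothesis-15886)

Machine-generated helper (proved); move `lemma_proposal`, op `llm`: `[prefix_stable]` appending gates never
changes earlier gate values — `gateValues gs <+: gateValues (gs ++ gs')`.
See docs/architecture/ttrl-lite.md. -/

namespace Summit.ValiantsHypothesis.ValiantsHypothesis.Theorems

open Summit.ValiantsHypothesis.ValiantsHypothesis.Theses.MonotoneRestoration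
open Literature.Computability.AlgebraicComplexity

/-- TTRL-lite variant V19261 (lemma_proposal `llm`, `[prefix_stable]`) of `stub_esymmRowSums_complexity`
(stmt-ValiantsHypothesis-15886): appending gates to a gate list never changes the values of the earlier
gates — the value list of `gs` is a prefix of the value list of `gs ++ gs'`; machine-found, kernel-checked. -/
theorem stub_esymmRowSums_complexity_var19261 :
    ∀ (σ : Type) (gs gs' : List (ArithCircuit.Gate NNReal σ)),
      ArithCircuit.gateValues gs <+: ArithCircuit.gateValues (gs ++ gs') := by
  intro σ gs gs'
  induction gs' using List.reverseRecOn with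
  | nil => simp
  | append_singleton gs' g ih =>
    rw [← List.append_assoc, ArithCircuit.gateValues_append_singleton]
    exact ih.trans (List.prefix_append _ _)

end Summit.ValiantsHypothesis.ValiantsHypothesis.Theorems
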